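import Mathlib
import Summits.CriticalPhenomena.PercolationContinuityZ3.Theorems.PercNearOneGluingNoHeavyLowerTailBoundaryBudget
import Summits.CriticalPhenomena.PercolationContinuityZ3.Theorems.PercNearOneGluingNoHeavyLowerTailHubTransfer
import HarnessLib

/-!
# `NoHeavyLowerTail` / `NearOneGluing` (stmt-CriticalPhenomena-4575 / 4574) — the DEPTH-TWO CLASS THEOREM

Helper file (lemma factory #1 `prim-lf-1`, gen 5; `--supports stmt-CriticalPhenomena-4575`), companion of
`…NoHeavyLowerTailBoundaryBudget.lean` (the boundary-budget bound `BoundaryBudget.gluingDefect_le_sum`) and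
`…NoHeavyLowerTailHubTransfer.lean` (the hub transfer).  No definitions, no sorries.

A DEPTH-TWO observer `o ∉ A` is one all of whose positive-weight non-relay neighbours are pendant relay-stars
(their positive-weight pairs go only to `o` and to `A`); the relay side is arbitrary:
`∀ x ∉ A, x ≠ o, w s(o,x) ≠ 0 → ∀ y ∉ A, y ≠ o, y ≠ x → w s(x,y) = 0`.

* `BoundaryBudget.depthTwo_pocket_subset` / `depthTwo_pocket_null` — a.s. the relay-free pocket of a depth-two
  observer lies in `{o} ∪ stars`; other pocket values are null.
* `BoundaryBudget.depthTwo_killed_eq_restrW` — for such pocket values the deep boundary is weightless, so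
  `μ{a ↮ b in ω ∖ K(S₀)} = P_{G−o}(a ↮ b)` (`G − o` = `restrW {o}ᶜ w`).
* `BoundaryBudget.depthTwo_eventGluingH` — the lead's DEPTH-TWO THEOREM (LEAD-GEN5 §4b), here a corollary of
  the boundary-budget bound: `∃ a ∈ A, μ(o ↔ A, o ↮ b) ≤ P_{G−o}(a ↮ b)` for every target `b ∈ A`, any number
  of stars and relays.
* `BoundaryBudget.depthTwo_notConn_le` — with the hub transfer: `μ(o ↮ b) ≤ μ(o ↮ A) + s + δ + δ/s` for every
  `s > 0` (`δ ≥ max_a μ(a ↮ b)`).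
* `BoundaryBudget.depthTwo_nearOneGluing` — KOZMA–NITZAN'S CONJECTURE 3 ON THE DEPTH-TWO CLASS, uniformly:
  `∀ ε > 0`, with `δ = min(ε²/16, ε/4)`: depth-two `o ∉ A`, `P(o ↔ A) > 1 − δ`, `P(a ↔ b) > 1 − δ` (`a ∈ A`)
  imply `P(o ↔ b) > 1 − ε` (any target `b`).
-/

namespace Summit.CriticalPhenomena.PercolationContinuityZ3.Theorems

open scoped BigOperators Classical
open MeasureTheory Set
open Literature.Probability.LatticeModels (prodBernoulli prodBernoulli_ae_forall_notMem)
open Literature.Probability.Percolation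

namespace BoundaryBudget

variable {n : ℕ}

/-! ### Depth-two observers: the lead's depth-two theorem and the class theorem -/

/-- **A.s. the relay-free pocket of a depth-two observer lies in `{o} ∪ stars`.**  If every positive-weight
non-relay neighbour `x` of `o` has weight-zero pairs to all non-relay vertices other than `o`, then on every
configuration using no weight-zero pair, `o ↔ v in Aᶜ` forces `v = o` or `v` a positive-weight non-relay
neighbour of `o`. -/
theorem depthTwo_pocket_subset {w : Sym2 (Fin n) → unitInterval} {A : Finset (Fin n)} {o : Fin n}
    (hD2 : ∀ x : Fin n, x ∉ A → x ≠ o → w s(o, x) ≠ 0 → ∀ y : Fin n, y ∉ A → y ≠ o → y ≠ x → w s(x, y) = 0)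
    {ω : Set (Sym2 (Fin n))} (hω : ∀ e : Sym2 (Fin n), w e = 0 → e ∉ ω) {v : Fin n}
    (hv : ω ∈ openConnIn (↑A : Set (Fin n))ᶜ o v) : v = o ∨ (v ∉ A ∧ w s(o, v) ≠ 0) := by
  have hp : PathIn (openGraph ω) (↑A : Set (Fin n))ᶜ o v := DCT16.pathIn_of_mem_openConnIn hv
  refine DCT16.pathIn_induction (fun u => u = o ∨ (u ∉ A ∧ w s(o, u) ≠ 0)) hp (Or.inl rfl) ?_
  intro x y _ hy hx hxy
  rw [openGraph_adj] at hxy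
  have hyA : y ∉ A := fun h => hy (Finset.mem_coe.2 h)
  have hw : w s(x, y) ≠ 0 := fun h0 => hω _ h0 hxy.1
  rcases hx with rfl | ⟨hxA, hxw⟩
  · exact Or.inr ⟨hyA, hw⟩
  · by_cases hyo : y = o
    · exact Or.inl hyo
    · by_cases hxo : x = o
      · subst hxo; exact Or.inr ⟨hyA, hw⟩
      · exact absurd (hD2 x hxA hxo hxw y hyA hyo (fun h => hxy.2 h.symm)) hw

/-- **Pocket values leaving `{o} ∪ stars` are null** for a depth-two observer. -/
theorem depthTwo_pocket_null (w : Sym2 (Fin n) → unitInterval) {A : Finset (Fin n)} {o : Fin n}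
    (hD2 : ∀ x : Fin n, x ∉ A → x ≠ o → w s(o, x) ≠ 0 → ∀ y : Fin n, y ∉ A → y ≠ o → y ≠ x → w s(x, y) = 0)
    {S₀ : Finset (Fin n)} {z : Fin n} (hz : z ∈ S₀) (hzo : z ≠ o) (hzw : z ∈ A ∨ w s(o, z) = 0) :
    (prodBernoulli w).real
        {ω : Set (Sym2 (Fin n)) | ∀ v : Fin n, ω ∈ openConnIn (↑A : Set (Fin n))ᶜ o v ↔ v ∈ S₀} = 0 := by
  set N : Set (Set (Sym2 (Fin n))) := {ω | ¬ ∀ e ∈ {e : Sym2 (Fin n) | w e = 0}, e ∉ ω} with hN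
  have hae := prodBernoulli_ae_forall_notMem w (Z := {e : Sym2 (Fin n) | w e = 0}) (Set.to_countable _)
    (fun e he => he)
  have hN0 : (prodBernoulli w).real N = 0 := by
    rw [measureReal_def, ae_iff.1 hae, ENNReal.toReal_zero]
  have hsub : {ω : Set (Sym2 (Fin n)) | ∀ v : Fin n, ω ∈ openConnIn (↑A : Set (Fin n))ᶜ o v ↔ v ∈ S₀} ⊆ N := by
    intro ω hω hgood
    have hv := depthTwo_pocket_subset hD2 (fun e he => hgood e he) ((hω z).2 hz)
    rcases hv with h | ⟨hzA, hzw'⟩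
    · exact hzo h
    · rcases hzw with h | h
      · exact hzA h
      · exact hzw' h
  exact le_antisymm ((measureReal_mono hsub (measure_ne_top _ _)).trans hN0.le) measureReal_nonneg

/-- **For pocket values inside `{o} ∪ stars` the killed graph is `G − o`** (a.s.): the deep boundary pairs of such
a pocket are weightless, so `μ{a ↮ b in ω ∖ K(S₀)} = P_{G−o}(a ↮ b)` for `a ≠ o`. -/
theorem depthTwo_killed_eq_restrW (w : Sym2 (Fin n) → unitInterval) {A S₀ : Finset (Fin n)} {o a : Fin n}
    (hD2 : ∀ x : Fin n, x ∉ A → x ≠ o → w s(o, x) ≠ 0 → ∀ y : Fin n, y ∉ A → y ≠ o → y ≠ x → w s(x, y) = 0)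
    (hS : ∀ z ∈ S₀, z = o ∨ (z ∉ A ∧ w s(o, z) ≠ 0)) (hao : a ≠ o) (b : Fin n) :
    (prodBernoulli w).real
        {ω : Set (Sym2 (Fin n)) |
          ω \ {e : Sym2 (Fin n) | o ∈ e ∨ ∃ x ∈ S₀, ∃ y, y ∉ S₀ ∧ y ∉ A ∧ e = s(x, y)} ∉ openConn a b} =
      (prodBernoulli (restrW ({o}ᶜ : Set (Fin n)) w)).real (openConn a b)ᶜ := by
  set K : Set (Sym2 (Fin n)) := {e | o ∈ e ∨ ∃ x ∈ S₀, ∃ y, y ∉ S₀ ∧ y ∉ A ∧ e = s(x, y)} with hK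
  rw [probReal_compl_eq_one_sub MeasurableSet.of_discrete, KNGoodAux.restrW_real_openConn w o hao b,
    ← probReal_compl_eq_one_sub MeasurableSet.of_discrete]
  have hae := prodBernoulli_ae_forall_notMem w (Z := {e : Sym2 (Fin n) | w e = 0}) (Set.to_countable _)
    (fun e he => he)
  refine measureReal_congr ?_
  filter_upwards [hae] with ω hω
  refine propext (not_congr ⟨fun h => ?_, fun h => ?_⟩)
  · -- a path of `ω \ K` avoids `o`
    have hp : PathIn (openGraph (ω \ K)) Set.univ a b := DCT16.pathIn_univ_of_reachable h
    have hp' : PathIn (openGraph (ω \ K)) ({o}ᶜ : Set (Fin n)) a b :=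
      pathIn_of_forall_adj_mem (fun p q hpq => by
        rw [openGraph_adj] at hpq
        intro hq
        rw [mem_singleton_iff] at hq
        exact hpq.1.2 (Or.inl (hq ▸ Sym2.mem_mk_right p q))) hao hp
    rw [DCT16.mem_openConnIn_iff_pathIn]
    exact DCT16.pathIn_congrGraph (fun p q _ _ hpq => by
      rw [openGraph_adj] at hpq ⊢
      exact ⟨hpq.1.1, hpq.2⟩) hp'
  · -- a path of `ω` inside `{o}ᶜ` uses no killed pair (deep boundary pairs are weightless, hence absent)
    have hp : PathIn (openGraph ω) ({o}ᶜ : Set (Fin n)) a b := DCT16.pathIn_of_mem_openConnIn h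
    have hp' : PathIn (openGraph (ω \ K)) ({o}ᶜ : Set (Fin n)) a b := by
      refine DCT16.pathIn_congrGraph (fun p q hp hq hpq => ?_) hp
      rw [mem_compl_iff, mem_singleton_iff] at hp hq
      rw [openGraph_adj] at hpq ⊢
      refine ⟨⟨hpq.1, ?_⟩, hpq.2⟩
      rintro (hoe | ⟨x, hx, y, hy, hyA, hxy⟩)
      · rcases Sym2.mem_iff.1 hoe with h' | h'
        · exact hp h'.symm
        · exact hq h'.symm
      · -- `s(p,q) = s(x,y)` with `x ∈ S₀` a star and `y ∉ S₀ ∪ A`: weightless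
        have hxo : x ≠ o := by
          intro h
          have : o ∈ s(p, q) := by rw [hxy]; exact Sym2.mem_iff.2 (Or.inl h.symm)
          rcases Sym2.mem_iff.1 this with h' | h'
          · exact hp h'.symm
          · exact hq h'.symm
        have hyo : y ≠ o := by
          intro h
          have : o ∈ s(p, q) := by rw [hxy]; exact Sym2.mem_iff.2 (Or.inr h.symm)
          rcases Sym2.mem_iff.1 this with h' | h'
          · exact hp h'.symm
          · exact hq h'.symm
        have hyx : y ≠ x := fun h => hy (h ▸ hx)
        rcases hS x hx with h' | ⟨hxA, hxw⟩
        · exact hxo h'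
        · have h0 : w s(x, y) = 0 := hD2 x hxA hxo hxw y hyA hyo hyx
          exact hω _ h0 (hxy ▸ hpq.1)
    exact DCT16.reachable_of_pathIn hp'

/-- **The depth-two theorem** (lead 4575, LEAD-GEN5 §4b, here from the boundary-budget bound): if every
positive-weight non-relay neighbour of the observer `o ∉ A` is a pendant relay-star (its positive-weight pairs
go only to `o` and to `A`), then for every target `b ∈ A` some relay `a ∈ A` satisfies
`μ(o ↔ A, o ↮ b) ≤ P_{G−o}(a ↮ b)`  (`G − o` = the weights restricted off `o`).  Any number of stars,
any relay side. -/
theorem depthTwo_eventGluingH (w : Sym2 (Fin n) → unitInterval) {A : Finset (Fin n)} {o b : Fin n}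
    (hoA : o ∉ A) (hb : b ∈ A)
    (hD2 : ∀ x : Fin n, x ∉ A → x ≠ o → w s(o, x) ≠ 0 → ∀ y : Fin n, y ∉ A → y ≠ o → y ≠ x → w s(x, y) = 0) :
    ∃ a ∈ A, (prodBernoulli w).real ((⋃ x ∈ A, openConn o x) ∩ (openConn o b)ᶜ) ≤
      (prodBernoulli (restrW ({o}ᶜ : Set (Fin n)) w)).real (openConn a b)ᶜ := by
  obtain ⟨sel, hselA, hsel⟩ := exists_admissible w A hb
  -- the relay maximising the `G − o` unreliability
  obtain ⟨a, ha, hmax⟩ := Finset.exists_max_image A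
    (fun a => (prodBernoulli (restrW ({o}ᶜ : Set (Fin n)) w)).real (openConn a b)ᶜ) ⟨b, hb⟩
  refine ⟨a, ha, ?_⟩
  set M := (prodBernoulli (restrW ({o}ᶜ : Set (Fin n)) w)).real (openConn a b)ᶜ with hM
  have hM0 : 0 ≤ M := measureReal_nonneg
  refine (gluingDefect_le_sum w A o b sel hoA hb (fun S₀ _ _ v hv _ => hsel S₀ v hv)).trans ?_
  refine le_trans (Finset.sum_le_sum (fun S₀ hS₀ => ?_) : _ ≤ ∑ S₀ ∈ (Finset.univ : Finset (Finset (Fin n))).filter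
      (fun S₀ => o ∈ S₀ ∧ Disjoint S₀ A),
        (prodBernoulli w).real
          {ω : Set (Sym2 (Fin n)) | ∀ v : Fin n, ω ∈ openConnIn (↑A : Set (Fin n))ᶜ o v ↔ v ∈ S₀} * M) ?_
  · -- per pocket value
    simp only [Finset.mem_filter, Finset.mem_univ, true_and] at hS₀
    obtain ⟨hoS, hSA⟩ := hS₀
    by_cases hgood : ∀ z ∈ S₀, z = o ∨ (z ∉ A ∧ w s(o, z) ≠ 0)
    · have hne : sel S₀ ≠ o := fun h => hoA (h ▸ hselA S₀)
      rw [depthTwo_killed_eq_restrW w hD2 hgood hne b]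
      exact mul_le_mul_of_nonneg_left (hmax _ (hselA S₀)) measureReal_nonneg
    · push Not at hgood
      obtain ⟨z, hz, hzo, hzw⟩ := hgood
      have hzw' : z ∈ A ∨ w s(o, z) = 0 := by
        by_cases hzA : z ∈ A
        · exact Or.inl hzA
        · exact Or.inr (by simpa using hzw hzA)
      rw [depthTwo_pocket_null w hD2 hz hzo hzw', zero_mul, zero_mul]
  · rw [← Finset.sum_mul]
    calc _ ≤ 1 * M := mul_le_mul_of_nonneg_right (sum_pocket_le_one w A o) hM0
      _ = M := one_mul M

/-- **Depth-two gluing, quantitative form** (with the hub transfer `HubTransfer.restrW_real_notConn_le_div`):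
for a depth-two observer `o ∉ A`, `b ∈ A`, `δ ≥ max_a μ(a ↮ b)` and every `s > 0`,
`μ(o ↮ b) ≤ μ(o ↮ A) + s + δ + δ / s`.  (If the relay `a` of `depthTwo_eventGluingH` has `μ(o ↮ a) ≥ s` its
`G − o` unreliability is `≤ δ/s`; otherwise glue through it.) -/
theorem depthTwo_notConn_le (w : Sym2 (Fin n) → unitInterval) {A : Finset (Fin n)} {o b : Fin n}
    (hoA : o ∉ A) (hb : b ∈ A)
    (hD2 : ∀ x : Fin n, x ∉ A → x ≠ o → w s(o, x) ≠ 0 → ∀ y : Fin n, y ∉ A → y ≠ o → y ≠ x → w s(x, y) = 0)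
    {δ s : ℝ} (hs : 0 < s) (hδ : ∀ a ∈ A, (prodBernoulli w).real (openConn a b)ᶜ ≤ δ) :
    (prodBernoulli w).real (openConn o b)ᶜ ≤
      (prodBernoulli w).real (⋃ x ∈ A, openConn o x)ᶜ + s + δ + δ / s := by
  set μ := prodBernoulli w with hμ
  obtain ⟨a, ha, hglue⟩ := depthTwo_eventGluingH w hoA hb hD2
  have hδ0 : 0 ≤ δ := le_trans measureReal_nonneg (hδ b hb)
  have hao : a ≠ o := fun h => hoA (h ▸ ha)
  -- `μ(o ↮ b) ≤ μ(o ↮ A) + μ(o ↔ A, o ↮ b)`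
  have hsplit : μ.real (openConn o b)ᶜ ≤ μ.real (⋃ x ∈ A, openConn o x)ᶜ +
      μ.real ((⋃ x ∈ A, openConn o x) ∩ (openConn o b)ᶜ) := by
    have hsub : (openConn o b : Set (Set (Sym2 (Fin n))))ᶜ ⊆
        (⋃ x ∈ A, openConn o x)ᶜ ∪ ((⋃ x ∈ A, openConn o x) ∩ (openConn o b)ᶜ) := by
      intro ω hω
      by_cases h : ω ∈ ⋃ x ∈ A, openConn o x
      · exact Or.inr ⟨h, hω⟩
      · exact Or.inl h
    exact (measureReal_mono hsub (measure_ne_top _ _)).trans (measureReal_union_le (μ := μ) _ _)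
  by_cases hcase : s ≤ μ.real (openConn o a)ᶜ
  · have hpos : 0 < μ.real (openConn o a)ᶜ := hs.trans_le hcase
    have h1 := HubTransfer.restrW_real_notConn_le_div w hao b hpos
    have h2 : μ.real (openConn a b)ᶜ / μ.real (openConn o a)ᶜ ≤ δ / s :=
      div_le_div₀ hδ0 (hδ a ha) hs hcase
    have h3 : 0 ≤ δ / s := div_nonneg hδ0 hs.le
    linarith
  · push Not at hcase
    have h1 := HubTransfer.real_openConn_ge_sub w o a b
    have h2 : μ.real (openConn a b)ᶜ ≤ δ := hδ a ha
    rw [probReal_compl_eq_one_sub MeasurableSet.of_discrete] at h2 ⊢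
    have h3 : 0 ≤ μ.real (⋃ x ∈ A, openConn o x)ᶜ := measureReal_nonneg
    have h4 : 0 ≤ δ / s := div_nonneg hδ0 hs.le
    linarith

/-- **Kozma–Nitzan's Conjecture 3 holds on the DEPTH-TWO CLASS**, uniformly: for every `ε > 0`, with
`δ = min(ε²/16, ε/4)`, on every finite weighted graph and every observer `o` all of whose positive-weight
non-relay neighbours are pendant relay-stars, `P(o ↔ A) > 1 − δ` and `P(a ↔ b) > 1 − δ` for all `a ∈ A`
imply `P(o ↔ b) > 1 − ε` (any target `b`; any number of stars and relays).  Boundary-budget bound with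
weightless deep boundary + hub transfer. -/
theorem depthTwo_nearOneGluing {ε : ℝ} (hε : 0 < ε) :
    ∃ δ : ℝ, 0 < δ ∧ ∀ (n : ℕ) (w : Sym2 (Fin n) → unitInterval) (A : Finset (Fin n)) (o b : Fin n),
      (∀ x : Fin n, x ∉ A → x ≠ o → w s(o, x) ≠ 0 → ∀ y : Fin n, y ∉ A → y ≠ o → y ≠ x → w s(x, y) = 0) →
      o ∉ A →
      1 - δ < (prodBernoulli w).real (⋃ a ∈ A, openConn o a) →
        (∀ a ∈ A, 1 - δ < (prodBernoulli w).real (openConn a b)) →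
          1 - ε < (prodBernoulli w).real (openConn o b) := by
  refine ⟨min (ε ^ 2 / 16) (ε / 4), lt_min (by positivity) (by positivity), ?_⟩
  intro n w A o b hD2 hoA hoA' hab
  set δ := min (ε ^ 2 / 16) (ε / 4) with hδdef
  -- trivial case `o = b`
  by_cases hob : o = b
  · subst hob
    have : (openConn o o : Set (Set (Sym2 (Fin n)))) = univ :=
      eq_univ_of_forall fun ω => SimpleGraph.Reachable.refl _
    rw [this, probReal_univ]
    linarith
  have hδ1 : δ ≤ ε ^ 2 / 16 := min_le_left _ _
  have hδ2 : δ ≤ ε / 4 := min_le_right _ _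
  set μ := prodBernoulli w with hμ
  -- pass to `A' = insert b A`
  set A' : Finset (Fin n) := insert b A with hA'
  have hoA2 : o ∉ A' := by
    rw [hA', Finset.mem_insert]
    rintro (h | h)
    exacts [hob h, hoA h]
  have hb : b ∈ A' := Finset.mem_insert_self b A
  have hD2' : ∀ x : Fin n, x ∉ A' → x ≠ o → w s(o, x) ≠ 0 →
      ∀ y : Fin n, y ∉ A' → y ≠ o → y ≠ x → w s(x, y) = 0 :=
    fun x hx hxo hw y hy hyo hyx =>
      hD2 x (fun h => hx (Finset.mem_insert_of_mem h)) hxo hw y (fun h => hy (Finset.mem_insert_of_mem h)) hyo hyx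
  have hδ' : ∀ a ∈ A', μ.real (openConn a b)ᶜ ≤ δ := by
    intro a ha'
    rw [hA', Finset.mem_insert] at ha'
    rcases ha' with rfl | haA
    · have : (openConn a a : Set (Set (Sym2 (Fin n))))ᶜ = ∅ := by
        rw [compl_empty_iff]
        exact eq_univ_of_forall fun ω => SimpleGraph.Reachable.refl _
      rw [this, measureReal_empty, hδdef]
      exact le_min (by positivity) (by positivity)
    · have := hab a haA
      rw [probReal_compl_eq_one_sub MeasurableSet.of_discrete]
      linarith
  have hmain := depthTwo_notConn_le w hoA2 hb hD2' (s := ε / 4) (by positivity) hδ'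
  -- `μ(o ↮ A') ≤ μ(o ↮ A) < δ`
  have hmono : μ.real (⋃ x ∈ A', openConn o x)ᶜ ≤ μ.real (⋃ x ∈ A, openConn o x)ᶜ := by
    refine measureReal_mono (compl_subset_compl.2 fun ω hω => ?_) (measure_ne_top _ _)
    simp only [mem_iUnion, exists_prop] at hω ⊢
    obtain ⟨x, hx, hωx⟩ := hω
    exact ⟨x, Finset.mem_insert_of_mem hx, hωx⟩
  have hA0 : μ.real (⋃ x ∈ A, openConn o x)ᶜ < δ := by
    rw [probReal_compl_eq_one_sub MeasurableSet.of_discrete]; linarith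
  have hdivs : δ / (ε / 4) ≤ ε / 4 := by
    rw [div_le_iff₀ (by positivity)]
    nlinarith
  rw [probReal_compl_eq_one_sub MeasurableSet.of_discrete] at hmain
  linarith

end BoundaryBudget

end Summit.CriticalPhenomena.PercolationContinuityZ3.Theorems
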